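/-
Copyright (c) 2026 the pub-hodgecm-mathlib formalisation cell (harness21).  Prover seat hodgecm-mathlib-A-p19 (g20), topic T5 = P8
«(C♯)hol interior», node C∞ — THE LETTER-LEVEL CLOSER (desk F0P2-plan (g9) 23:23Z «THEOREMS road»).  KERNEL: theorems only.
-/
import Literature.NumberTheory.Automorphic.Liu2021.ThetaLiftFromLineTorusCovariance
import Literature.NumberTheory.Automorphic.Liu2021.ThetaLiftFromLineCompactInvariance
import Literature.NumberTheory.Automorphic.Liu2021.ThetaLiftFromLineContinuity
import Literature.NumberTheory.Automorphic.Liu2021.ThetaLiftFromLineArchTypes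
import Literature.NumberTheory.GelbartRogawski1991.ArchLocalUnitarySurjective
import Literature.NumberTheory.Automorphic.Liu2021.Def411WeilCarriersArchPlaceSign
import Literature.Geometry.ComplexHyperbolic.UnitBallFrameTorus
import Summits.HodgeConjecture.HodgeConjecture.Theorems.F0P3HolProjectionReduction
import Summits.HodgeConjecture.HodgeConjecture.Theorems.F0P2aCohFormsContinuous
import Literature.NumberTheory.GelbartRogawski1991.QuadExtSplittingCharArchType
import Literature.NumberTheory.Automorphic.IdeleClassBaseChangePosReal
import Literature.NumberTheory.Automorphic.IdeleClassCharacterHecke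
import Literature.NumberTheory.Automorphic.ConjugateSelfDualInfinityType
import HarnessLib

/-!
# Node C∞ of the (C♯)hol interior HOLDS — ★ `Liu2021.meetsThetaLiftFromLine_hol_archTypeAt` (p826262) PROVED
# ([Liu2021, App. D Lem. D.2 (2)]: «in `{ω_{2,1}^{m,±,l}}` only `ω^{−1,−,0}_{2,1}` is isomorphic to `π^{1,0}_{2,1}`»)

Topic `Summits/HodgeConjecture` (T5 = P8 «(C♯)hol interior», node C∞); namespace `Summit.HodgeConjecture.HodgeConjecture.Cruxes.H413.F0P2oCinfArchTypeAtHolds`.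
KERNEL ONLY: one public theorem, hypothesis-free, and private lemmas; 0 definitions, 0 records, 0 `sorry`.

`meetsThetaLiftFromLine_hol_archTypeAt_holds : Liu2021.meetsThetaLiftFromLine_hol_archTypeAt` — in the (C♯)hol frame, a discrete `P` of `U(H)` meeting the
theta lift from the line `⟨a⟩` at the `μ`-splitting and holomorphic-cotangent at `ι` has `exponentAt hμ.infinityType ι = −1` and `Im ι(a·(2δ)⁻¹) < 0`.
PROOF = the road «K-type of `(1,0)`-forms» (all inputs ★): S4 ★ `eq_cmAdelicFrameTransport_of_coe`; a non-zero cotangent class (★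
`exists_toLp_ne_zero_of_mem_cohForms_cm`) and node B's theta data (★ `exists_chi_starProjection_ne_zero_of_holCotForm_tensor`); the frame `C = T⁻¹ι(g)`,
`Cᴴ J C = diag σ_{v₀}(dV)`, its negative index `p₋` and fixed point `x₁ = [C e_{p₋}]`, `h x₀ = x₁` (★ `UnitBallFrameTorus`, ★ `exists_smul_x₀_eq`); the
`K_∞`-covariant classes `w_j = R(σh)[Φ_j]` (★ FILE 1 §3) and the pairing `Λ^β_j = ⟪w_j, pr_P [Θ̃_{E(h^V_β ⊗ Φ_f)}]⟫`, which is an EIGENVECTOR of the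
isotropy Jacobian `Jac k_s x₀` with the Weil eigenvalue `∏ s^{n(β)}` (★ (WT) `exists_U21_smul_starProjection_toLp_lineThetaLift_follandHermite`, ★ `K_c`
fixes `P`, unitarity of `R` and of `Jac k x₀`), non-zero for some `β` (★ cyclicity `exists_tmul_inner_starProjection_toLp_lineThetaLift_ne_zero` + ★
`clm_eq_of_eq_on_hermitePi`); ★ `exists_eq_eigenvalue_of_forall_mulVec_eq_smul` and ★ `eq_of_forall_prod_zpow_eq` turn this into the integer equations
`n(β) = ε(δ_{p_j} − δ_{p₋})` (P2 bus 2026-08-31T23:27Z, F0P2-ref1 r211), whose only solutions are `(ε, τ_w) = (+1, −1)` with `σ_{v₀}(a)/δ_{v₀} > 0` or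
`(−1, +1)` with `< 0` — the letter via ★ `exponentAt_embedding ∕ _conjugate_embedding` and ★ `im_embedding_cmPlaceOver_mul_inv_two_imagUnit`.

HONEST SCOPE.  This proves ONE booked letter of the (C♯)hol interior (node C∞; T5a line `stub_Cinf_archTypeAt`); HC_CM is NOT proved here or anywhere
in the tree — it stays conditional on the remaining named inputs (hLiu418, h413) until rung 0 closes.

References: [Liu2021] proof of Prop. 4.13 Case 1 (l. 2137–2141, p. 48), App. D Lem. D.2 (2) (l. 5285), Rem. 4.2 / Def. 4.3; [KonnoKonno2007] Thm. 5.4,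
Lem. 5.2; [BorelWallach2000] VI 4.7; [Folland1989] Prop. (4.39); [BorelJacquet1979] §4.6.
-/

set_option autoImplicit false
set_option linter.dupNamespace false

noncomputable section

open NumberField NumberField.InfinitePlace MeasureTheory IsDedekindDomain MulAction
open scoped Matrix ComplexOrder ENNReal TensorProduct SchwartzMap Kronecker Classical InnerProductSpace ComplexConjugate

namespace Summit.HodgeConjecture.HodgeConjecture.Cruxes.H413.F0P2oCinfArchTypeAtHolds

open _root_.MeasureTheory
open Literature.NumberTheory.Automorphic Literature.NumberTheory.Automorphic.UnitaryGroup
open Literature.NumberTheory.Automorphic.UnitaryGroup.CotangentForms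
open Literature.NumberTheory.Automorphic.IdeleClassGroup
open Literature.NumberTheory.Automorphic.Liu2021 Literature.NumberTheory.Automorphic.Liu2021.CinfThetaTorus
open Literature.NumberTheory.Automorphic.Liu2021.Def411WeilCarriers
open Literature.NumberTheory.Automorphic.Liu2021.Def411WeilCarriersDoubling
open Literature.NumberTheory.GelbartRogawski1991 Literature.NumberTheory.GelbartRogawski1991.UnitaryDualPair
open Literature.NumberTheory.GelbartRogawski1991.GRConstruction
open Literature.NumberTheory.Weil1964
open Literature.RepresentationTheory.Liu2021
open Literature.RepresentationTheory.HeisenbergGroup Literature.Analysis.SegalBargmann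
open Literature.RepresentationTheory.KonnoKonno2007
open Literature.AlgebraicGeometry.ShimuraVarieties Literature.Geometry.ComplexHyperbolic Literature.Geometry.ComplexHyperbolic.BallModel

/-! ## §1 The pairing with the `K_∞`-covariant classes turns an `R(σ(h k h⁻¹))`-eigen-identity into a `Jac k x₀`-eigenvector -/

section Pairing

variable (L : Type) [Field L] [NumberField L] [IsCMField L] (ι : L →+* ℂ) (H : Matrix (Fin 3) (Fin 3) L) (T : GL (Fin 3) ℂ)
  (hT : (T : Matrix (Fin 3) (Fin 3) ℂ)ᴴ * H.map ι * (T : Matrix (Fin 3) (Fin 3) ℂ) = BallModel.J)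
  {μA : Measure (adelicGroupData (↥(maximalRealSubfield L)) L (IsCMField.complexConj L) 3 H).automorphicQuotient}
  [(adelicGroupData (↥(maximalRealSubfield L)) L (IsCMField.complexConj L) 3 H).IsAutomorphicMeasure μA]
  (P : DiscreteAutomorphicRep (adelicGroupData (↥(maximalRealSubfield L)) L (IsCMField.complexConj L) 3 H) μA)
  {Φh : (adelicGroupData (↥(maximalRealSubfield L)) L (IsCMField.complexConj L) 3 H).Adelic → (Fin 2 → ℂ)}
  (hΦh : Φh ∈ holCotForms (↥(maximalRealSubfield L)) L (IsCMField.complexConj L) 3 H (cmArchSection L ι H T hT) (cmCompactFactor L ι H T hT))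
  (hm : ∀ j : Fin 2, MemLp (toQuotFun (adelicGroupData (↥(maximalRealSubfield L)) L (IsCMField.complexConj L) 3 H) fun x => Φh x j) 2 μA)
  {j₀ : Fin 2} (hj₀mem : (hm j₀).toLp _ ∈ P.space.toSubmodule) (hj₀ne : (hm j₀).toLp _ ≠ 0)

/-- `Jac k x₀` is unitary for `k ∈ Stab(x₀)`: `(Jac k x₀)ᴴ * Jac k x₀ = 1` (`Jac = (k₂₂)⁻¹ ulBlock`, ★ `ulBlock_unitary_of_smul_x₀`). [cite: BorelWallach2000, VI 4.7] -/
private theorem conjTranspose_Jac_mul_self (k : stabilizer U21 x₀) : (Jac (k : U21) x₀)ᴴ * Jac (k : U21) x₀ = 1 := by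
  have hk : (k : U21) • x₀ = x₀ := mem_stabilizer_iff.mp k.2
  obtain ⟨hA, hd⟩ := ulBlock_unitary_of_smul_x₀ hk
  rw [Jac_x₀_of_smul_x₀ hk, Matrix.conjTranspose_smul, Matrix.smul_mul, Matrix.mul_smul, hA, smul_smul, star_inv₀, Complex.star_def,
    ← mul_inv, hd, inv_one, one_smul]

include hΦh hj₀mem hj₀ne in
/-- **THE PAIRING LEMMA**: if `c • X = R(σ(h k h⁻¹)) (R(k_c) X)` with `X ∈ P`, `k ∈ Stab(x₀)`, `k_c ∈ K_c`, then the vector `Λ_j = ⟪R(σh)[Φ_j], X⟫` satisfies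
`Jac k x₀ *ᵥ Λ = c • Λ` (★ FILE 1 §3 at `k⁻¹`, ★ `K_c` fixes `P`, unitarity of `R` and of `Jac k x₀`). [cite: BorelWallach2000, VI 4.7] [cite: BorelJacquet1979, §4.6] -/
private theorem jac_mulVec_pairing (h : U21) (k : stabilizer U21 x₀) {kc : (adelicGroupData (↥(maximalRealSubfield L)) L (IsCMField.complexConj L) 3 H).Adelic}
    (hkc : kc ∈ cmCompactFactor L ι H T hT) {X : (adelicGroupData (↥(maximalRealSubfield L)) L (IsCMField.complexConj L) 3 H).L2 μA}
    (hX : X ∈ P.space.toSubmodule) {c : ℂ}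
    (hc : c • X = (adelicGroupData (↥(maximalRealSubfield L)) L (IsCMField.complexConj L) 3 H).rightRegular μA (cmArchSection L ι H T hT (h * k * h⁻¹))
      ((adelicGroupData (↥(maximalRealSubfield L)) L (IsCMField.complexConj L) 3 H).rightRegular μA kc X)) :
    Jac (k : U21) x₀ *ᵥ (fun i : Fin 2 => ⟪(adelicGroupData (↥(maximalRealSubfield L)) L (IsCMField.complexConj L) 3 H).rightRegular μA
        (cmArchSection L ι H T hT h) ((hm i).toLp _), X⟫_ℂ) =
      c • fun i : Fin 2 => ⟪(adelicGroupData (↥(maximalRealSubfield L)) L (IsCMField.complexConj L) 3 H).rightRegular μA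
        (cmArchSection L ι H T hT h) ((hm i).toLp _), X⟫_ℂ := by
  set R := (adelicGroupData (↥(maximalRealSubfield L)) L (IsCMField.complexConj L) 3 H).rightRegular μA with hR
  have hRU := (adelicGroupData (↥(maximalRealSubfield L)) L (IsCMField.complexConj L) 3 H).isUnitary_rightRegular μA
  -- `K_c` fixes `P`
  rw [rightRegular_eq_self_of_mem_cmCompactFactor L ι H T hT P hΦh (hm j₀) hj₀mem hj₀ne hkc hX] at hc
  -- `Jac k⁻¹ x₀ = (Jac k x₀)ᴴ`
  set M := Jac (k : U21) x₀ with hM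
  have hk0 : (k : U21) • x₀ = x₀ := mem_stabilizer_iff.mp k.2
  have hMinv : Jac ((k⁻¹ : stabilizer U21 x₀) : U21) x₀ = Mᴴ := by
    have h1 : Jac ((k : U21)⁻¹) x₀ * M = 1 := by
      have := Jac_inv_mul (k : U21) x₀; rwa [hk0] at this
    have h2 : Mᴴ * M = 1 := conjTranspose_Jac_mul_self k
    have hMu : IsUnit M.det := Matrix.isUnit_det_of_left_inverse h2
    rw [show ((k⁻¹ : stabilizer U21 x₀) : U21) = (k : U21)⁻¹ from rfl, ← Matrix.inv_eq_left_inv h1, Matrix.inv_eq_left_inv h2]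
  funext i
  rw [Pi.smul_apply, smul_eq_mul, ← inner_smul_right, hc]
  -- `⟪w_i, R(g) X⟫ = ⟪R(g⁻¹) w_i, X⟫`
  have hadj : ∀ (gp : (adelicGroupData (↥(maximalRealSubfield L)) L (IsCMField.complexConj L) 3 H).Adelic) (x y : _),
      ⟪x, R gp y⟫_ℂ = ⟪R gp⁻¹ x, y⟫_ℂ := fun gp x y => by
    rw [← hRU.inner_map_map gp⁻¹ x (R gp y)]
    congr 1
    show (R gp⁻¹ * R gp) y = y
    rw [← map_mul, inv_mul_cancel, map_one]
    rfl
  rw [hadj, ← map_inv, show (h * (k : U21) * h⁻¹)⁻¹ = h * ((k⁻¹ : stabilizer U21 x₀) : U21) * h⁻¹ by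
      rw [show ((k⁻¹ : stabilizer U21 x₀) : U21) = (k : U21)⁻¹ from rfl]; group,
    rightRegular_conj_cmArchSection_toLp_toQuotFun L ι H T hT hΦh hm h k⁻¹ i, sum_inner, hMinv]
  simp only [Matrix.mulVec, dotProduct, inner_smul_left, Matrix.conjTranspose_apply, starRingEnd_apply, star_star]
  rfl

end Pairing

/-! ## §2 Small algebra: the integer equations and the torus character of a pair of indices -/

/-- `∏_p (s p)^(ε at p₁, −ε at p₂, 0 else) = (s p₁)^ε · (s p₂)^{−ε}`. [cite: BrockerTomDieck1985, II Prop. 8.1] -/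
private theorem prod_zpow_two_indices (s : Fin 3 → ℂ) {p₁ p₂ : Fin 3} (h12 : p₁ ≠ p₂) (A B : ℤ) :
    ∏ p : Fin 3, s p ^ (if p = p₁ then A else if p = p₂ then B else 0) = s p₁ ^ A * s p₂ ^ B := by
  rw [← Finset.mul_prod_erase _ _ (Finset.mem_univ p₁), ← Finset.mul_prod_erase _ _ (Finset.mem_erase.2 ⟨Ne.symm h12, Finset.mem_univ p₂⟩),
    Finset.prod_eq_one (fun p hp => by
      obtain ⟨hp2, hp'⟩ := Finset.mem_erase.1 hp
      obtain ⟨hp1, -⟩ := Finset.mem_erase.1 hp'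
      rw [if_neg hp1, if_neg hp2, zpow_zero]), mul_one, if_pos rfl, if_neg (Ne.symm h12), if_pos rfl]

/-- THE INTEGER EQUATIONS (P2 bus 2026-08-31T23:27Z; F0P2-ref1 r211): with `c ∈ ℤ`, `b ∈ ℕ³`, `ε = ±1`, `P p ↔ 0 < d_p κ` (`d_{p₋} < 0 < d_{p_j}, d_{p′}`),
`n p = if P p then c + b p else c − 1 − b p`, the equations `n p_j = ε`, `n p′ = 0`, `n p₋ = −ε` force `(0 < κ ∧ ε = 1 ∧ c = 0) ∨ (κ < 0 ∧ ε = −1 ∧ c = 1)`.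
[cite: Liu2021, App. D Lem. D.2 (2) p. 127 (l. 5285)] [cite: KonnoKonno2007, Thm. 5.4] -/
private theorem integer_equations {c : ℤ} {bj b' bm : ℕ} {ε : ℤ} (hε : ε = 1 ∨ ε = -1) {κ dj d' dm : ℝ} (hκ : κ ≠ 0)
    (hdj : 0 < dj) (hd' : 0 < d') (hdm : dm < 0)
    (hj : (if 0 < dj * κ then c + bj else c - 1 - bj) = ε) (h' : (if 0 < d' * κ then c + b' else c - 1 - b') = 0)
    (hmm : (if 0 < dm * κ then c + bm else c - 1 - bm) = -ε) :
    (0 < κ ∧ ε = 1 ∧ c = 0) ∨ (κ < 0 ∧ ε = -1 ∧ c = 1) := by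
  rcases lt_or_gt_of_ne hκ with hκ | hκ
  · right
    rw [if_neg (not_lt.2 (mul_nonpos_of_nonneg_of_nonpos hdj.le hκ.le)), ] at hj
    rw [if_neg (not_lt.2 (mul_nonpos_of_nonneg_of_nonpos hd'.le hκ.le))] at h'
    rw [if_pos (mul_pos_of_neg_of_neg hdm hκ)] at hmm
    refine ⟨hκ, ?_, ?_⟩ <;> omega
  · left
    rw [if_pos (mul_pos hdj hκ)] at hj
    rw [if_pos (mul_pos hd' hκ)] at h'
    rw [if_neg (not_lt.2 (mul_nonpos_of_nonpos_of_nonneg hdm.le hκ.le))] at hmm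
    refine ⟨hκ, ?_, ?_⟩ <;> omega

/-! ## §3 The closer -/

set_option maxHeartbeats 4000000 in
-- (the letter's binder list and the theta/frame telescopes are large; every step is a named ★ lemma)
/-- **NODE C∞ OF THE (C♯)hol INTERIOR HOLDS — ★ `Liu2021.meetsThetaLiftFromLine_hol_archTypeAt` PROVED** ([Liu2021, App. D Lem. D.2 (2)] applied at the
place of `ι`): a holomorphic-cotangent `P` meeting the theta lift from `⟨a⟩` has `exponentAt hμ.infinityType ι = −1` and `Im ι(a·(2δ)⁻¹) < 0`.  See the module
docstring for the road (every input ★). [cite: Liu2021, App. D Lem. D.2 (2) p. 127 (l. 5285); Prop. 4.13 proof Case 1 (l. 2137–2141, p. 48)]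
[cite: KonnoKonno2007, Thm. 5.4] [cite: BorelWallach2000, VI 4.7] [cite: Folland1989, Prop. (4.39)] [cite: BorelJacquet1979, §4.6] -/
theorem meetsThetaLiftFromLine_hol_archTypeAt_holds : Liu2021.meetsThetaLiftFromLine_hol_archTypeAt := by
  intro L _ _ _ ι H T hT hdef h2 n' e₁ dV hdV hdV0 g hg ιA hιA _ μA _ P μ hμ a hmeet hhol
  haveI : CompactSpace (adelicGroupData (↥(maximalRealSubfield L)) L (IsCMField.complexConj L) 3 H).automorphicQuotient :=
    F0P3HolProjectionReduction.compactSpace_automorphicQuotient_cm hdef h2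
  obtain rfl := eq_cmAdelicFrameTransport_of_coe L 3 H dV g hg ιA hιA
  obtain ⟨Φh, hΦh, hΦne, hcont⟩ := hhol
  have hm : ∀ j : Fin 2, MemLp (toQuotFun (adelicGroupData (↥(maximalRealSubfield L)) L (IsCMField.complexConj L) 3 H) fun x => Φh x j) 2 μA :=
    fun j => (hcont j).choose
  have hmem : ∀ j : Fin 2, (hm j).toLp _ ∈ P.space.toSubmodule := fun j => (hcont j).choose_spec
  obtain ⟨j₀, hj₀⟩ := F0P2aCohFormsContinuous.exists_toLp_ne_zero_of_mem_cohForms_cm (holCotForms_le_cohForms hΦh) hΦne hm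
  -- node B's theta data and a non-zero projected class
  letI : MeasurableSpace (↥(UnitaryGroup.adelic (↥(maximalRealSubfield L)) L (IsCMField.complexConj L) 1 (JW (↥(maximalRealSubfield L)) L a)) ⧸ (UnitaryGroup.toAdelic (↥(maximalRealSubfield L)) L (IsCMField.complexConj L) 1 (JW (↥(maximalRealSubfield L)) L a)).range) := borel _
  haveI : BorelSpace (↥(UnitaryGroup.adelic (↥(maximalRealSubfield L)) L (IsCMField.complexConj L) 1 (JW (↥(maximalRealSubfield L)) L a)) ⧸ (UnitaryGroup.toAdelic (↥(maximalRealSubfield L)) L (IsCMField.complexConj L) 1 (JW (↥(maximalRealSubfield L)) L a)).range) := ⟨rfl⟩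
  haveI := normal_range_toAdelic_JW L a
  obtain ⟨hρ, μW, hfinm, hinv, Φinf, Φfin, hfin, χ, hθ, hne⟩ :=
    hmeet.exists_chi_starProjection_ne_zero_of_holCotForm_tensor L ι H T hT e₁ dV hdV hdV0 g hg μ hμ a P hΦh (hm j₀) (hmem j₀) hj₀
  haveI : IsFiniteMeasure μW := hfinm
  haveI : SMulInvariantMeasure ↥(UnitaryGroup.adelic (↥(maximalRealSubfield L)) L (IsCMField.complexConj L) 1 (JW (↥(maximalRealSubfield L)) L a)) (↥(UnitaryGroup.adelic (↥(maximalRealSubfield L)) L (IsCMField.complexConj L) 1 (JW (↥(maximalRealSubfield L)) L a)) ⧸ (UnitaryGroup.toAdelic (↥(maximalRealSubfield L)) L (IsCMField.complexConj L) 1 (JW (↥(maximalRealSubfield L)) L a)).range) μW := hinv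
  set f₀ := Literature.RepresentationTheory.CompactGroups.charCM (chiQuot (↥(maximalRealSubfield L)) L (IsCMField.complexConj L) (Algebra.IsQuadraticExtension.finrank_eq_two _ L)
    (IsCMField.complexConj_ne_one (K := L)) a χ) with hf₀
  have hne' : P.space.toSubmodule.starProjection (MemLp.toLp _ (memLp_toQuotFun_lineThetaLift L 3 H e₁ dV hdV hdV0 g hg μ hμ a hρ μW
      ⟨fun v => Φinf (piArch (↥(maximalRealSubfield L)) (Fin n') v) * Φfin (piFinite (↥(maximalRealSubfield L)) (Fin n') v),
        tensor_mem_piSchwartzBruhat Φinf hfin⟩ f₀ μA 2)) ≠ 0 := hne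
  -- the place of `ι`, the real place below it, the archimedean type
  let v₀ : {v : InfinitePlace (↥(maximalRealSubfield L)) // v.IsReal} :=
    ⟨(InfinitePlace.mk ι).comap (algebraMap (↥(maximalRealSubfield L)) L),
      Literature.NumberTheory.GelbartRogawski1991.UnitaryDualPair.ArchSplitting.QuadExt.isReal_comap_of_smul_eq (F := ↥(maximalRealSubfield L))
        (E := L) (c := IsCMField.complexConj L) (w := ⟨InfinitePlace.mk ι, IsTotallyComplex.isComplex _⟩) (complexConj_smul_infinitePlace L _)
        (IsCMField.complexConj_ne_one L)⟩
  have hw₀ : (cmPlaceOver L v₀).1 = InfinitePlace.mk ι := comap_injective_of_isCMField (L := L) (cmPlaceOver_comap L v₀)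
  have hv₀ : cmPlaceOver L v₀ = placeOf L ι (isComplex_mk_of_isCMField L ι) := Subtype.ext hw₀
  have hτ : (toHeckeCharacter L μ).HasUnitaryArchType hμ.infinityType 0 :=
    (hasUnitaryArchType_toHeckeCharacter_iff L μ _).2 hμ.hasInfinityType_infinityType
  have hodd : ∀ w, Odd (hμ.infinityType w) := hμ.odd_infinityType
  -- the frame `C = T⁻¹ ι(g)` with `Cᴴ J C = diag σ_{v₀}(dV)`
  set C : GL (Fin 3) ℂ := T⁻¹ * Matrix.GeneralLinearGroup.map ι g with hCdef
  let d : Fin 3 → ℝ := fun p => embedding_of_isReal v₀.2 (⟨dV p, (IsCMField.complexConj_eq_self_iff (K := L) (dV p)).1 (hdV p)⟩ : ↥(maximalRealSubfield L))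
  have hd : ∀ p, ι (dV p) = ((d p : ℝ) : ℂ) := fun p => by
    have h1 := embedding_cmPlaceOver_dV L dV hdV v₀ p
    rw [hw₀] at h1
    -- `ι` and the embedding of its place agree on the real element `dV p`
    by_cases hι : (InfinitePlace.mk ι).embedding = ι
    · rw [← hι]; exact h1
    · have h2 := embedding_mk_eq_conjugate_of_ne L ι hι
      rw [h2, NumberField.ComplexEmbedding.conjugate_coe_eq] at h1
      rw [← Complex.conj_conj (ι (dV p)), h1, Complex.conj_ofReal]
  have hC : ((C : Matrix (Fin 3) (Fin 3) ℂ))ᴴ * BallModel.J * (C : Matrix (Fin 3) (Fin 3) ℂ) = Matrix.diagonal fun p => ((d p : ℝ) : ℂ) := by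
    have hJ : ((T⁻¹ : GL (Fin 3) ℂ) : Matrix (Fin 3) (Fin 3) ℂ)ᴴ * BallModel.J * ((T⁻¹ : GL (Fin 3) ℂ) : Matrix (Fin 3) (Fin 3) ℂ) = H.map ι := by
      rw [← hT]
      have hTT : (T : Matrix (Fin 3) (Fin 3) ℂ) * ((T⁻¹ : GL (Fin 3) ℂ) : Matrix (Fin 3) (Fin 3) ℂ) = 1 := by
        rw [← Units.val_mul, mul_inv_cancel, Units.val_one]
      calc ((T⁻¹ : GL (Fin 3) ℂ) : Matrix (Fin 3) (Fin 3) ℂ)ᴴ * ((T : Matrix (Fin 3) (Fin 3) ℂ)ᴴ * H.map ι * (T : Matrix (Fin 3) (Fin 3) ℂ)) *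
            ((T⁻¹ : GL (Fin 3) ℂ) : Matrix (Fin 3) (Fin 3) ℂ)
          = ((T : Matrix (Fin 3) (Fin 3) ℂ) * ((T⁻¹ : GL (Fin 3) ℂ) : Matrix (Fin 3) (Fin 3) ℂ))ᴴ * H.map ι *
              ((T : Matrix (Fin 3) (Fin 3) ℂ) * ((T⁻¹ : GL (Fin 3) ℂ) : Matrix (Fin 3) (Fin 3) ℂ)) := by
            simp only [Matrix.conjTranspose_mul, Matrix.mul_assoc]
        _ = H.map ι := by rw [hTT, Matrix.conjTranspose_one, Matrix.one_mul, Matrix.mul_one]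
    have hgι : ((Matrix.GeneralLinearGroup.map ι g : GL (Fin 3) ℂ) : Matrix (Fin 3) (Fin 3) ℂ)ᴴ * H.map ι *
        ((Matrix.GeneralLinearGroup.map ι g : GL (Fin 3) ℂ) : Matrix (Fin 3) (Fin 3) ℂ) = Matrix.diagonal fun p => ((d p : ℝ) : ℂ) := by
      have h1 := congrArg (fun M : Matrix (Fin 3) (Fin 3) L => M.map ι) hg
      simp only [Matrix.map_mul, Matrix.diagonal_map (map_zero ι)] at h1
      have hconj : (((g : Matrix (Fin 3) (Fin 3) L).map (cmConjRingHom L))ᵀ).map ι =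
          (((Matrix.GeneralLinearGroup.map ι g : GL (Fin 3) ℂ) : Matrix (Fin 3) (Fin 3) ℂ))ᴴ := by
        ext i j
        simp only [Matrix.map_apply, Matrix.transpose_apply, Matrix.conjTranspose_apply, embedding_cmConjRingHom, Complex.star_def]
        rfl
      rw [hconj] at h1
      rw [show (((Matrix.GeneralLinearGroup.map ι g : GL (Fin 3) ℂ) : Matrix (Fin 3) (Fin 3) ℂ)) = (g : Matrix (Fin 3) (Fin 3) L).map ι from rfl] at h1 ⊢
      rw [h1]
      exact congrArg Matrix.diagonal (funext fun p => hd p)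
    rw [hCdef, Units.val_mul, Matrix.conjTranspose_mul]
    calc ((Matrix.GeneralLinearGroup.map ι g : GL (Fin 3) ℂ) : Matrix (Fin 3) (Fin 3) ℂ)ᴴ * ((T⁻¹ : GL (Fin 3) ℂ) : Matrix (Fin 3) (Fin 3) ℂ)ᴴ *
          BallModel.J * (((T⁻¹ : GL (Fin 3) ℂ) : Matrix (Fin 3) (Fin 3) ℂ) * (Matrix.GeneralLinearGroup.map ι g : GL (Fin 3) ℂ))
        = ((Matrix.GeneralLinearGroup.map ι g : GL (Fin 3) ℂ) : Matrix (Fin 3) (Fin 3) ℂ)ᴴ *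
            (((T⁻¹ : GL (Fin 3) ℂ) : Matrix (Fin 3) (Fin 3) ℂ)ᴴ * BallModel.J * ((T⁻¹ : GL (Fin 3) ℂ) : Matrix (Fin 3) (Fin 3) ℂ)) *
            (Matrix.GeneralLinearGroup.map ι g : GL (Fin 3) ℂ) := by simp only [Matrix.mul_assoc]
      _ = _ := by rw [hJ, hgι]
  -- the negative index, the fixed point, the transport `h x₀ = x₁`
  obtain ⟨pm, hpm⟩ := exists_neg C d hC
  obtain ⟨h, hh⟩ := exists_smul_x₀_eq (proj _ (Q_col_neg C d hC hpm))
  have h₁ : pm + 1 ≠ pm := by fin_cases pm <;> decide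
  have h₂ : pm + 2 ≠ pm := by fin_cases pm <;> decide
  have h12 : pm + 1 ≠ pm + 2 := by fin_cases pm <;> decide
  -- the twisted torus
  have hs' : ∀ (s : Fin 3 → ℂ), (∀ p, star (s p) * s p = 1) → ∀ p, star (embTwist L ι (s p)) * embTwist L ι (s p) = 1 := fun s hs p => by
    rw [Complex.star_def, ← embTwist_conj, ← map_mul, ← Complex.star_def, hs p, map_one]
  -- the pairing vector `Λ^β_i = ⟪R(σh)[Φ_i], pr_P [Θ̃_{E(h^V_β ⊗ Φ_f)}]⟫` is a `Jac k_s x₀`-eigenvector with the Weil eigenvalue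
  set eV := frameV L e₁ dV hdV hdV0 (lineW L (TW (↥(maximalRealSubfield L)) a)) (complexConj_lineW L (TW (↥(maximalRealSubfield L)) a))
    (lineW_ne_zero L (TW (↥(maximalRealSubfield L)) a) (isUnit_det_TW (↥(maximalRealSubfield L)) a)) with heV
  have hEig : ∀ (β : (Fin n' × {v : InfinitePlace (↥(maximalRealSubfield L)) // v.IsReal}) →₀ ℕ) (Φf : FinSB (↥(maximalRealSubfield L)) (Fin n'))
      (s : Fin 3 → ℂ) (hs : ∀ p, star (s p) * s p = 1),
      Jac (h⁻¹ * mkU21 _ (frameTorus_mem C d hC (fun p => embTwist L ι (s p)) (hs' s hs)) * h) x₀ *ᵥ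
          (fun i : Fin 2 => ⟪(adelicGroupData (↥(maximalRealSubfield L)) L (IsCMField.complexConj L) 3 H).rightRegular μA (cmArchSection L ι H T hT h)
            ((hm i).toLp _), P.space.toSubmodule.starProjection (MemLp.toLp _ (memLp_toQuotFun_lineThetaLift L 3 H e₁ dV hdV hdV0 g hg μ hμ a hρ μW
              (piSchwartzBruhatEquiv (↥(maximalRealSubfield L)) (Fin n') (follandHermite eV β ⊗ₜ Φf)) f₀ μA 2))⟫_ℂ) =
        (∏ p : Fin 3, s p ^ (if 0 < signVec (cmPlaceOver L) (cmGramEntry L e₁ dV hdV (lineW L (TW (↥(maximalRealSubfield L)) a))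
            (complexConj_lineW L (TW (↥(maximalRealSubfield L)) a))) (imagUnit L) v₀ (e₁ (p, 0))
          then (hμ.infinityType (cmPlaceOver L v₀).1 + 1) / 2 + β (e₁ (p, 0), v₀)
          else (hμ.infinityType (cmPlaceOver L v₀).1 + 1) / 2 - 1 - β (e₁ (p, 0), v₀))) •
        fun i : Fin 2 => ⟪(adelicGroupData (↥(maximalRealSubfield L)) L (IsCMField.complexConj L) 3 H).rightRegular μA (cmArchSection L ι H T hT h)
            ((hm i).toLp _), P.space.toSubmodule.starProjection (MemLp.toLp _ (memLp_toQuotFun_lineThetaLift L 3 H e₁ dV hdV hdV0 g hg μ hμ a hρ μW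
              (piSchwartzBruhatEquiv (↥(maximalRealSubfield L)) (Fin n') (follandHermite eV β ⊗ₜ Φf)) f₀ μA 2))⟫_ℂ := by
    intro β Φf s hs
    obtain ⟨U, kc, hkc, hU, hcov⟩ := exists_U21_smul_starProjection_toLp_lineThetaLift_follandHermite L ι H T hT e₁ dV hdV hdV0 g hg μ hμ a hρ μW
      f₀ P v₀ hv₀ hτ hodd s hs β Φf
    let k₀ : stabilizer U21 x₀ := ⟨h⁻¹ * mkU21 _ (frameTorus_mem C d hC (fun p => embTwist L ι (s p)) (hs' s hs)) * h,
        mem_stabilizer_iff.mpr (conj_frameTorus_smul_x₀ C d hC hpm h hh _ (hs' s hs))⟩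
    have hk₀ : (k₀ : U21) = h⁻¹ * mkU21 _ (frameTorus_mem C d hC (fun p => embTwist L ι (s p)) (hs' s hs)) * h := rfl
    have hUk : U = h * k₀ * h⁻¹ := by
      rw [hk₀, ← mul_assoc, ← mul_assoc, mul_inv_cancel, one_mul, mul_assoc, mul_inv_cancel, mul_one]
      exact Subtype.ext (Units.ext hU)
    rw [hUk] at hcov
    have hpair := jac_mulVec_pairing L ι H T hT P hΦh hm (hmem j₀) hj₀ h k₀ hkc (P.space.toSubmodule.starProjection_apply_mem _) hcov
    rw [hk₀] at hpair
    exact hpair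
  -- a pure tensor, then a Hermite box, with non-zero pairing against `w_{j₀}`
  have hwmem : (adelicGroupData (↥(maximalRealSubfield L)) L (IsCMField.complexConj L) 3 H).rightRegular μA (cmArchSection L ι H T hT h)
      ((hm j₀).toLp _) ∈ P.space.toSubmodule := P.space.apply_mem_toSubmodule _ (hmem j₀)
  have hwne : (adelicGroupData (↥(maximalRealSubfield L)) L (IsCMField.complexConj L) 3 H).rightRegular μA (cmArchSection L ι H T hT h)
      ((hm j₀).toLp _) ≠ 0 := fun h0 => hj₀ (by
    rw [← norm_eq_zero, ← ((adelicGroupData (↥(maximalRealSubfield L)) L (IsCMField.complexConj L) 3 H).isUnitary_rightRegular μA).norm_map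
      (cmArchSection L ι H T hT h) ((hm j₀).toLp _), h0, norm_zero])
  obtain ⟨φ, Φf, hφ⟩ := exists_tmul_inner_starProjection_toLp_lineThetaLift_ne_zero L H e₁ dV hdV hdV0 g hg μ hμ a hρ μW f₀ P _ hne' hwmem hwne
  obtain ⟨Tθ, hTθ⟩ := exists_clm_comp_toLp_lineThetaLift_tmul L 3 H e₁ dV hdV hdV0 g hg μ hμ a hρ μW f₀ μA
    ((innerSL ℂ ((adelicGroupData (↥(maximalRealSubfield L)) L (IsCMField.complexConj L) 3 H).rightRegular μA (cmArchSection L ι H T hT h)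
      ((hm j₀).toLp _))).comp P.space.toSubmodule.starProjection) Φf
  obtain ⟨β, hβ⟩ : ∃ β : (Fin n' × {v : InfinitePlace (↥(maximalRealSubfield L)) // v.IsReal}) →₀ ℕ,
      ⟪(adelicGroupData (↥(maximalRealSubfield L)) L (IsCMField.complexConj L) 3 H).rightRegular μA (cmArchSection L ι H T hT h) ((hm j₀).toLp _),
        P.space.toSubmodule.starProjection (MemLp.toLp _ (memLp_toQuotFun_lineThetaLift L 3 H e₁ dV hdV hdV0 g hg μ hμ a hρ μW
          (piSchwartzBruhatEquiv (↥(maximalRealSubfield L)) (Fin n') (follandHermite eV β ⊗ₜ Φf)) f₀ μA 2))⟫_ℂ ≠ 0 := by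
    by_contra hall
    push Not at hall
    have hT0 : Tθ.comp ((schwartzTransport eV).symm : _ ≃L[ℂ] _).toContinuousLinearMap = 0 :=
      clm_eq_of_eq_on_hermitePi fun β' => by
        show Tθ ((schwartzTransport eV).symm (hermitePi β')) = 0
        rw [hTθ]
        exact hall β'
    apply hφ
    have h1 : Tθ φ = 0 := by
      have := congrArg (fun S => S (schwartzTransport eV φ)) hT0
      simpa using this
    rw [hTθ] at h1
    exact h1
  -- the eigenvector read-out: ONE eigenvalue function of the frame for all `s`
  let S : Type := {s : Fin 3 → ℂ // ∀ p, star (s p) * s p = 1}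
  set Λ : Fin 2 → ℂ := fun i : Fin 2 => ⟪(adelicGroupData (↥(maximalRealSubfield L)) L (IsCMField.complexConj L) 3 H).rightRegular μA (cmArchSection L ι H T hT h)
      ((hm i).toLp _), P.space.toSubmodule.starProjection (MemLp.toLp _ (memLp_toQuotFun_lineThetaLift L 3 H e₁ dV hdV hdV0 g hg μ hμ a hρ μW
        (piSchwartzBruhatEquiv (↥(maximalRealSubfield L)) (Fin n') (follandHermite eV β ⊗ₜ Φf)) f₀ μA 2))⟫_ℂ with hΛ
  have hΛne : Λ ≠ 0 := fun h0 => hβ (by have := congrFun h0 j₀; simpa [hΛ] using this)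
  set n : Fin 3 → ℤ := fun p => if 0 < signVec (cmPlaceOver L) (cmGramEntry L e₁ dV hdV (lineW L (TW (↥(maximalRealSubfield L)) a))
      (complexConj_lineW L (TW (↥(maximalRealSubfield L)) a))) (imagUnit L) v₀ (e₁ (p, 0))
    then (hμ.infinityType (cmPlaceOver L v₀).1 + 1) / 2 + β (e₁ (p, 0), v₀)
    else (hμ.infinityType (cmPlaceOver L v₀).1 + 1) / 2 - 1 - β (e₁ (p, 0), v₀) with hn
  obtain ⟨j, hj⟩ := exists_eq_eigenvalue_of_forall_mulVec_eq_smul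
    (fun s : S => Jac (h⁻¹ * mkU21 _ (frameTorus_mem C d hC (fun p => embTwist L ι (s.1 p)) (hs' s.1 s.2)) * h) x₀)
    _ (isUnit_transport_frame C d hC hpm h hh h₁ h₂ h12)
    (fun s : S => ![embTwist L ι (s.1 (pm + 1)) * (embTwist L ι (s.1 pm))⁻¹, embTwist L ι (s.1 (pm + 2)) * (embTwist L ι (s.1 pm))⁻¹])
    (fun s => Jac_conj_frameTorus_mul_frame C d hC hpm h hh _ (hs' s.1 s.2) h₁ h₂) hΛne (fun s : S => ∏ p : Fin 3, s.1 p ^ n p)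
    (fun s => hEig β Φf s.1 s.2)
  -- the twist sign `ε` and the integer vector equation
  set ε : ℤ := if (InfinitePlace.mk ι).embedding = ι then 1 else -1 with hεdef
  have hε : ε = 1 ∨ ε = -1 := by rw [hεdef]; split_ifs <;> simp
  have htw : ∀ z : ℂ, star z * z = 1 → embTwist L ι z = z ^ ε := fun z hz => by
    rw [hεdef]
    by_cases hι : (InfinitePlace.mk ι).embedding = ι
    · rw [if_pos hι, embTwist_apply_of_eq L ι hι, zpow_one]
    · rw [if_neg hι, embTwist_apply_of_ne L ι hι, zpow_neg, zpow_one, ← Complex.star_def]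
      exact eq_inv_of_mul_eq_one_left hz
  obtain ⟨pj, p', hpjm, hp'm, hp'j, hj'⟩ : ∃ pj p' : Fin 3, pj ≠ pm ∧ p' ≠ pm ∧ p' ≠ pj ∧
      ∀ s : S, ∏ p : Fin 3, s.1 p ^ n p = embTwist L ι (s.1 pj) * (embTwist L ι (s.1 pm))⁻¹ := by
    fin_cases j
    · exact ⟨pm + 1, pm + 2, h₁, h₂, h12.symm, fun s => by simpa using hj s⟩
    · exact ⟨pm + 2, pm + 1, h₂, h₁, h12, fun s => by simpa using hj s⟩
  have hvec : n = fun p => if p = pj then ε else if p = pm then -ε else 0 := by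
    refine eq_of_forall_prod_zpow_eq n _ fun s hs => ?_
    rw [hj' ⟨s, hs⟩, prod_zpow_two_indices s hpjm, zpow_neg, htw _ (hs pj), htw _ (hs pm)]
  -- the three coordinates
  have hnj : n pj = ε := by simpa using congrFun hvec pj
  have hn' : n p' = 0 := by simpa [if_neg hp'j, if_neg hp'm] using congrFun hvec p'
  have hnm : n pm = -ε := by simpa [if_neg hpjm.symm] using congrFun hvec pm
  -- the sign vector at `v₀`: `x_{v₀}(e₁(p,0)) = σ(dV p) · (σ(a)/δ)`
  have hsign : ∀ p : Fin 3, signVec (cmPlaceOver L) (cmGramEntry L e₁ dV hdV (lineW L (TW (↥(maximalRealSubfield L)) a))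
      (complexConj_lineW L (TW (↥(maximalRealSubfield L)) a))) (imagUnit L) v₀ (e₁ (p, 0)) =
      d p * (embedding_of_isReal v₀.2 (a : ↥(maximalRealSubfield L)) / deltaIm (cmPlaceOver L) (imagUnit L) v₀) := fun p => by
    rw [signVec_cmGramEntry_eq, Equiv.symm_apply_apply, mul_div_assoc]
    rfl
  have hd0 : deltaIm (cmPlaceOver L) (imagUnit L) v₀ ≠ 0 :=
    deltaIm_ne_zero (IsCMField.complexConj_ne_one L) (cmPlaceOver_smul L) (complexConj_imagUnit L) (imagUnit_ne_zero L) v₀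
  have hκ : embedding_of_isReal v₀.2 (a : ↥(maximalRealSubfield L)) / deltaIm (cmPlaceOver L) (imagUnit L) v₀ ≠ 0 :=
    div_ne_zero ((map_ne_zero _).2 (Units.ne_zero a)) hd0
  simp only [hn, hsign] at hnj hn' hnm
  obtain ⟨m, hm'⟩ := hodd (cmPlaceOver L v₀).1
  have key := integer_equations (c := (hμ.infinityType (cmPlaceOver L v₀).1 + 1) / 2) hε hκ (pos_of_ne C d hC hpm hpjm) (pos_of_ne C d hC hpm hp'm) hpm
    hnj hn' hnm
  -- the dictionary
  have hIm : ((cmPlaceOver L v₀).1.embedding (algebraMap (↥(maximalRealSubfield L)) L a * (2 * imagUnit L)⁻¹)).im =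
      -embedding_of_isReal v₀.2 (a : ↥(maximalRealSubfield L)) / (2 * deltaIm (cmPlaceOver L) (imagUnit L) v₀) :=
    im_embedding_cmPlaceOver_mul_inv_two_imagUnit L v₀ (a : ↥(maximalRealSubfield L))
  rcases key with ⟨hpos, hε1, hc⟩ | ⟨hneg, hε1, hc⟩
  · -- `ε = 1`: `ι` is the embedding of its place
    have hι : (InfinitePlace.mk ι).embedding = ι := by
      by_contra hι; rw [hεdef, if_neg hι] at hε1; norm_num at hε1
    have hιw : ι = (cmPlaceOver L v₀).1.embedding := by rw [hw₀, hι]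
    refine ⟨by rw [hιw, exponentAt_embedding]; omega, ?_⟩
    rw [hιw, hIm, neg_div, neg_lt_zero, mul_comm (2 : ℝ), ← div_div]
    exact div_pos (lt_of_le_of_ne (le_of_lt hpos) hκ.symm) two_pos
  · -- `ε = −1`: `ι` is the conjugate of the embedding of its place
    have hι : (InfinitePlace.mk ι).embedding ≠ ι := by
      intro hι; rw [hεdef, if_pos hι] at hε1; norm_num at hε1
    have hιw : ι = NumberField.ComplexEmbedding.conjugate (cmPlaceOver L v₀).1.embedding := by
      rw [hw₀, embedding_mk_eq_conjugate_of_ne L ι hι]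
      ext z; simp
    refine ⟨by rw [hιw, exponentAt_conjugate_embedding _ (cmPlaceOver L v₀).2]; omega, ?_⟩
    rw [hιw, NumberField.ComplexEmbedding.conjugate_coe_eq, Complex.conj_im, hIm, neg_div, neg_neg, mul_comm (2 : ℝ), ← div_div]
    exact div_neg_of_neg_of_pos hneg two_pos

end Summit.HodgeConjecture.HodgeConjecture.Cruxes.H413.F0P2oCinfArchTypeAtHolds

end
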